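import Literature.NumberTheory.Automorphic.TotallyRealModularity
import HarnessLib

/-!
# Modularity of elliptic curves over totally real fields of small degree: proofs file
# (Box 2022, Thm. 1.1 — the weak forms of its conclusion, and the hypotheses of the lifting
# theorems for the fields of Thm. 1.1)

Sibling proofs file (theorems only: no definitions, no named facts, no instances) of
`Literature.NumberTheory.Automorphic.TotallyRealModularity`, whose named fact
`Box2022_theorem1_1` renders J. Box, *Elliptic curves over totally real quartic fields not
containing `√5` are modular*, Trans. Amer. Math. Soc. 375 (2022), doi:10.1090/tran/8557
= arXiv:2103.13975 [Box2022], **Theorem 1.1** (p. 3 of the held text `paper:arxiv-2103.13975`):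
*Let `E` be an elliptic curve over a totally real quartic number field not containing a square
root of `5`. Then `E` is modular.*

## Status of the discharge `Box2022_theorem1_1_holds` (triage 2026-08-15: XL)

No discharge is possible in the tree today. The printed proof ([Box2022], §1.2 and §§2–6) is:
* **Thm. 1.3** (consequences of modularity lifting theorems) — for a non-modular `E` over a
  totally real `K`: (i) `Im ρ̄_{E,3}` is conjugate to a subgroup of `C_s⁺(3)` or `B(3)`
  (modularity lifting after Breuil–Diamond, i.e. Freitas–Le Hung–Siksek 2015 Thm. 3, and Rubin);
  (ii) if `√5 ∉ K`, `Im ρ̄_{E,5} ⊆ B(5)` (Thorne, Math. Ann. 364 (2016)); (iii) if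
  `K ∩ ℚ(ζ₇) = ℚ`, `Im ρ̄_{E,7} ⊆ B(7)` or `G(e7)` (Kalyanswamy, Math. Res. Lett. 25 (2018), who
  assumes `ζ₇ + ζ₇⁻¹ ∉ K`, combined with FLS 2015 on the subgroups of `C_ns⁺(7)`);
* **Thm. 1.2** — hence a non-modular `E` over `K` with `K ∩ ℚ(√5) = ℚ = K ∩ ℚ(ζ₇)` gives a
  `K`-point on one of `X(b3,b5,b7) = X₀(105)`, `X(s3,b5,b7)`, `X(b3,b5,e7)`, `X(s3,b5,e7)`
  (moduli interpretation of the modular curves `X_G/ℚ`, Deligne–Rapoport, §1.1);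
* **Thm. 1.5** — all quartic points with quartic `j`-invariant on these four curves (genera
  `13, 21, 73, 153`) are `ℚ`-curves or have a non-totally-real `j` (§§3–6: ten Atkin–Lehner
  quotients of `X₀(105)` of genus `≤ 5`, the genus-`3` hyperelliptic `X(b5,b7)`, `X(s3,b7)`,
  relative symmetric Chabauty on `X(b5,ns7)`, Chabauty plus a Mordell–Weil sieve on two quotients
  of genus `5, 6, 8`; Magma, `github.com/joshabox/quarticpoints`);
* **Thm. 1.4** (Ribet) — `ℚ`-curves are modular; and for quartic points whose `j` has degree `1`
  or `2`: modularity over `ℚ` (Wiles, BCDT) and over real quadratic fields (FLS 2015 Thm. 1 = the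
  named fact `FLS2015_theorem1`), with twist-invariance of modularity (p. 5).

None of the lifting theorems (i)–(iii), the curves `X_G/ℚ` with their moduli interpretation, the
residual-image conditions `Im ρ̄_{E,p} ⊆ B(p) / C_s⁺(p) / C_ns⁺(p)` over a number field, or the
point enumeration of Thm. 1.5 has a carrier or a proof in Mathlib/Literature (the same is recorded
for FLS Thm. 1 in `FreitasLeHungSiksekModularity` and for Caraiani–Newton in
`CaraianiNewtonModularityProofs`); `FLS2015_theorem1` is itself an undischarged named fact.

## Contents (all proved)

The formal bookkeeping around the fact:
* `Box2022_theorem1_1.isHilbertModular`, `Box2022_theorem1_1.isModularEllipticCurve` — the two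
  weak forms of the conclusion (`IsHilbertModular`, and Caraiani–Newton's trace-only
  `IsModularEllipticCurve`), through the proved bridges of the statement file;
* the first, field-theoretic step of the printed deduction of Thm. 1.1 from Thms. 1.2/1.3 — for
  the fields of Thm. 1.1 the hypotheses of the lifting theorems hold:
  `Box2022.not_isSquare_five_iff` (the rendering `¬ IsSquare (5 : K)` of "not containing a square
  root of `5`" is "`X² - 5` irreducible over `K`", i.e. `K ∩ ℚ(√5) = ℚ`, Thm. 1.2 / 1.3(ii)),
  `Box2022.sqrt_five_not_mem_range` (`√5 ∉ K` inside any extension), and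
  `Box2022.zeta7_add_inv_not_mem_range`: **`ζ₇ + ζ₇⁻¹ ∉ K` for every number field of degree
  `4`** (Kalyanswamy's hypothesis in Thm. 1.3(iii)), because `ζ₇ + ζ₇⁻¹` is a root of
  `X³ + X² - 2X - 1` (`Box2022.zeta7_add_inv_cubic`), which is irreducible over `ℚ` (monic,
  irreducible mod `2`; Gauss) so that a root in `K` would force `3 ∣ [K : ℚ]`
  (`Box2022.cubic7_ne_zero`).

Mathlib used: `X_pow_sub_C_irreducible_iff_of_prime`, `IsPrimitiveRoot.geom_sum_eq_zero`,
`Polynomial.irreducible_of_degree_le_three_of_not_isRoot`,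
`Polynomial.Monic.irreducible_of_irreducible_map`,
`Polynomial.Monic.irreducible_iff_irreducible_map_fraction_map` (Gauss's lemma),
`minpoly.eq_of_irreducible_of_monic`, `IntermediateField.adjoin.finrank`,
`Module.finrank_mul_finrank`. No `sorry`, no new definitions.

## References

* [Box2022] J. Box, Trans. Amer. Math. Soc. 375 (2022), doi:10.1090/tran/8557 =
  arXiv:2103.13975: Thm. 1.1, Thm. 1.2, Thm. 1.3 and its proof, Thm. 1.4, Thm. 1.5 (pp. 3–5 of the
  held text), §§2–6.
* [FreitasLeHungSiksek2015] Invent. Math. 201 (2015) 159–206, Thms. 1 and 3.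
-/

open scoped NumberField Polynomial IntermediateField
open NumberField Polynomial

noncomputable section

namespace Literature.NumberTheory.Automorphic

/-- Box's theorem gives Hilbert modularity in the cofinite sense `IsHilbertModular` of every
integral model with `Δ ≠ 0` over a totally real quartic field not containing `√5`
(`IsHilbertModular.of_isAutomorphicOfWeightZero`). [cite: Box2022, Thm. 1.1] -/
theorem Box2022_theorem1_1.isHilbertModular (h : Box2022_theorem1_1) (K : Type) [Field K]
    [NumberField K] [IsTotallyReal K] (hd : Module.finrank ℚ K = 4) (h5 : ¬ IsSquare (5 : K))
    {E : WeierstrassCurve (𝓞 K)} (hE : E.Δ ≠ 0) : IsHilbertModular E :=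
  IsHilbertModular.of_isAutomorphicOfWeightZero hE (h K hd h5 E hE)

/-- Box's theorem gives modularity in the trace-only sense `IsModularEllipticCurve` of
Caraiani–Newton (`IsHilbertModular.isModularEllipticCurve`). [cite: Box2022, Thm. 1.1] -/
theorem Box2022_theorem1_1.isModularEllipticCurve (h : Box2022_theorem1_1) (K : Type) [Field K]
    [NumberField K] [IsTotallyReal K] (hd : Module.finrank ℚ K = 4) (h5 : ¬ IsSquare (5 : K))
    {E : WeierstrassCurve (𝓞 K)} (hE : E.Δ ≠ 0) : IsModularEllipticCurve K E :=
  (h.isHilbertModular K hd h5 hE).isModularEllipticCurve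

/-- **"`K` does not contain a square root of `5`" = "`K ∩ ℚ(√5) = ℚ`".** For a field `K`, the
rendering `¬ IsSquare (5 : K)` of the hypothesis of Thm. 1.1 says exactly that `X² - 5` remains
irreducible over `K`, i.e. `K` contains no subfield `ℚ(√5)` (the form `K ∩ ℚ(√5) = ℚ` of the
hypothesis in Thm. 1.2 and Thm. 1.3(ii)). Mathlib `X_pow_sub_C_irreducible_iff_of_prime`.
[cite: Box2022, Thm. 1.2 and Thm. 1.3(ii)] -/
theorem Box2022.not_isSquare_five_iff {K : Type*} [Field K] :
    ¬ IsSquare (5 : K) ↔ Irreducible (X ^ 2 - C (5 : K)) := by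
  rw [X_pow_sub_C_irreducible_iff_of_prime Nat.prime_two, IsSquare, not_exists]
  refine forall_congr' fun b => ?_
  rw [sq, ne_eq, eq_comm]

/-- `√5 ∉ K` in any extension: if `¬ IsSquare (5 : K)` then no square root of `5` in a field
`L ⊇ K` lies in (the image of) `K`. [cite: Box2022, Thm. 1.3(ii)] -/
theorem Box2022.sqrt_five_not_mem_range {K L : Type*} [Field K] [Field L] [Algebra K L]
    (h5 : ¬ IsSquare (5 : K)) {r : L} (hr : r ^ 2 = 5) : r ∉ Set.range (algebraMap K L) := by
  rintro ⟨s, rfl⟩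
  refine h5 ⟨s, (algebraMap K L).injective ?_⟩
  rw [map_mul, ← sq, hr, map_ofNat]

/-- `η = ζ₇ + ζ₇⁻¹` is a root of `X³ + X² - 2X - 1` (the minimal polynomial of `2 cos (2π/7)`,
generator of the real cubic subfield `ℚ(ζ₇)⁺`), for any primitive `7`-th root of unity `ζ₇` in a
field: expand and use `1 + ζ + ⋯ + ζ⁶ = 0`. [folklore] -/
theorem Box2022.zeta7_add_inv_cubic {L : Type*} [Field L] {ζ : L} (hζ : IsPrimitiveRoot ζ 7) :
    (ζ + ζ⁻¹) ^ 3 + (ζ + ζ⁻¹) ^ 2 - 2 * (ζ + ζ⁻¹) - 1 = 0 := by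
  have h7 : ζ ^ 7 = 1 := hζ.pow_eq_one
  have hsum : ∑ i ∈ Finset.range 7, ζ ^ i = 0 := hζ.geom_sum_eq_zero (by norm_num)
  simp only [Finset.sum_range_succ, Finset.sum_range_zero, zero_add, pow_zero, pow_one] at hsum
  have hinv : ζ⁻¹ = ζ ^ 6 := inv_eq_of_mul_eq_one_right (by rw [← pow_succ', h7])
  rw [hinv]
  linear_combination hsum + (ζ ^ 11 + 3 * ζ ^ 6 + ζ ^ 5 + ζ ^ 4 + 3 * ζ + 2) * h7

/-- The cubic `X³ + X² - 2X - 1 ∈ ℤ[X]` is irreducible modulo `2` (it is `X³ + X² + 1`, of degree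
`3` without roots in `𝔽₂`). [folklore] -/
private theorem Box2022.irreducible_cubic7_mod_two :
    Irreducible ((X ^ 3 + X ^ 2 - 2 * X - 1 : ℤ[X]).map (Int.castRingHom (ZMod 2))) := by
  have hmap : (X ^ 3 + X ^ 2 - 2 * X - 1 : ℤ[X]).map (Int.castRingHom (ZMod 2)) =
      X ^ 3 + X ^ 2 - 2 * X - 1 := by
    simp only [Polynomial.map_sub, Polynomial.map_add, Polynomial.map_pow, Polynomial.map_mul,
      map_X, Polynomial.map_ofNat, Polynomial.map_one]
  rw [hmap]
  refine irreducible_of_degree_le_three_of_not_isRoot ?_ ?_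
  · have : (X ^ 3 + X ^ 2 - 2 * X - 1 : (ZMod 2)[X]).natDegree = 3 := by compute_degree!
    rw [this]
    decide
  · intro x
    fin_cases x <;> simp [IsRoot] <;> decide

/-- The cubic `X³ + X² - 2X - 1 ∈ ℚ[X]` is irreducible (it is monic over `ℤ` and irreducible
modulo `2`; Gauss's lemma). [folklore] -/
private theorem Box2022.irreducible_cubic7 :
    Irreducible (X ^ 3 + X ^ 2 - 2 * X - 1 : ℚ[X]) := by
  have hmonic : (X ^ 3 + X ^ 2 - 2 * X - 1 : ℤ[X]).Monic := by monicity!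
  have hZ : Irreducible (X ^ 3 + X ^ 2 - 2 * X - 1 : ℤ[X]) :=
    hmonic.irreducible_of_irreducible_map _ _ Box2022.irreducible_cubic7_mod_two
  have hQ := (hmonic.irreducible_iff_irreducible_map_fraction_map (K := ℚ)).1 hZ
  simpa only [Polynomial.map_sub, Polynomial.map_add, Polynomial.map_pow, Polynomial.map_mul,
    map_X, Polynomial.map_ofNat, Polynomial.map_one] using hQ

/-- **`X³ + X² - 2X - 1` has no root in a number field of degree prime to `3`**: a root `x` would
have minimal polynomial this irreducible cubic, so `[ℚ(x) : ℚ] = 3` would divide `[K : ℚ]`.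
[folklore] -/
theorem Box2022.cubic7_ne_zero {K : Type*} [Field K] [NumberField K]
    (hK : ¬ 3 ∣ Module.finrank ℚ K) (x : K) : x ^ 3 + x ^ 2 - 2 * x - 1 ≠ 0 := by
  intro hx
  set p : ℚ[X] := X ^ 3 + X ^ 2 - 2 * X - 1 with hp
  have hirr : Irreducible p := Box2022.irreducible_cubic7
  have hmonic : p.Monic := by rw [hp]; monicity!
  have hdeg : p.natDegree = 3 := by rw [hp]; compute_degree!
  have hroot : Polynomial.aeval x p = 0 := by
    simp only [hp, map_sub, map_add, map_pow, map_mul, aeval_X, map_ofNat, map_one]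
    exact hx
  have hint : IsIntegral ℚ x := ⟨p, hmonic, by rwa [← Polynomial.aeval_def]⟩
  have hmin : minpoly ℚ x = p := (minpoly.eq_of_irreducible_of_monic hirr hroot hmonic).symm
  have hfin : Module.finrank ℚ ℚ⟮x⟯ = 3 := by
    rw [IntermediateField.adjoin.finrank hint, hmin, hdeg]
  exact hK (hfin ▸ Dvd.intro _ (Module.finrank_mul_finrank ℚ ℚ⟮x⟯ K))

/-- **`ζ₇ + ζ₇⁻¹ ∉ K` for a quartic number field `K`** — the hypothesis of Kalyanswamy's theorem
("if `ζ₇ + ζ₇⁻¹ ∉ K`, then `Im ρ̄_{E,7}` is conjugate to a subgroup of `B(7)` or `C_ns⁺(7)`",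
quoted in the proof of Thm. 1.3(iii)) holds for every field of Thm. 1.1, indeed for every number
field of degree `4`: for any field `L ⊇ K` and any primitive `7`-th root of unity `ζ ∈ L`,
`ζ + ζ⁻¹` is not in (the image of) `K`, since it is a root of the irreducible cubic
`X³ + X² - 2X - 1` (`Box2022.zeta7_add_inv_cubic`, `Box2022.cubic7_ne_zero`) and `3 ∤ 4`.
[cite: Box2022, Thm. 1.3(iii) and its proof] -/
theorem Box2022.zeta7_add_inv_not_mem_range {K L : Type*} [Field K] [NumberField K] [Field L]
    [Algebra K L] (hd : Module.finrank ℚ K = 4) {ζ : L} (hζ : IsPrimitiveRoot ζ 7) :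
    ζ + ζ⁻¹ ∉ Set.range (algebraMap K L) := by
  rintro ⟨x, hx⟩
  have h3 : ¬ 3 ∣ Module.finrank ℚ K := by rw [hd]; decide
  refine Box2022.cubic7_ne_zero h3 x ((algebraMap K L).injective ?_)
  rw [map_sub, map_sub, map_add, map_pow, map_pow, map_mul, map_ofNat, map_one, map_zero, hx]
  exact Box2022.zeta7_add_inv_cubic hζ

end Literature.NumberTheory.Automorphic

end
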